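import Literature.AlgebraicGeometry.ComplexMultiplication.EndomorphismFieldLieAlgebraSignature
import Literature.AlgebraicGeometry.ComplexMultiplication.EndomorphismFieldDeterminantCondition
import HarnessLib

/-!
# Kottwitz's determinant condition AS PRINTED — for a `ℚ`-basis `α₁, …, α_t` of `F` acting on `Lie(A)`:
# `det(X₁α₁ + ⋯ + X_tα_t ; Lie A) = ∏_{φ ∈ Φ} (X₁φ(α₁) + ⋯ + X_tφ(α_t))`, for every basis of `Lie(A)`

Topic `Literature/AlgebraicGeometry/ComplexMultiplication` (family `hodge`, lane `lit-hodgefound`; the ALGEBRAIC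
carrier `Motives.AbelianVariety ℂ`, Shimura's pairs `(A, ι : F →+* A.endAlgebra)`, `[F : ℚ] = 2 dim A`, THE type
`Φ = cmTypeOfPair ι hF`).  Junction of `EndomorphismFieldDeterminantCondition` (g26-#10: the determinant
polynomial of a family of GENUINE endomorphisms on `𝔪_e/𝔪_e²`) with `EndomorphismFieldLieAlgebraSignature` (g26-#11:
the rational action `L(a) = Motives.AbelianVariety.lieAction A (ι a)` of every `a ∈ F` on `Lie(A)` is diagonal
with characters `Φ`).  Kottwitz's `det_V` is defined for a `k`-BASIS `α₁, …, α_t` of the algebra `B`; on Shimura's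
pair `B = F`, `V = Lie(A)`, and through the rational action no lift to `End(A)` is needed, so the condition can be
stated for an honest `ℚ`-basis of `F` (that `det_V` then DETERMINES `Φ` is Kottwitz's lemma, file
`EndomorphismFieldDeterminantConditionDeterminesType`).

PRINTED STATEMENTS.  R. Kottwitz [Kottwitz1992] §5 pp. 389–390 (held text `paper:doi-10-2307-2152772` p. 18):
«Let `α₁, …, α_t ; X₁, …, X_t` be as before [a basis of `𝒪_B ⊗ ℤ_{(p)}` and indeterminates]. Then the
determinant of the `𝒪_S`-linear endomorphism `X₁α₁ + ⋯ + X_tα_t` of `Lie(A)` is a homogeneous polynomial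
`g(X₁, …, X_t)` of degree `dim_S(A)` … we require that `g` be equal to the polynomial `f` … `det_V =
det(X₁α₁ + ⋯ + X_tα_t ; V ⊗_k k[X₁, …, X_t])`. Then `V` is isomorphic to `W` if and only if `det_V = det_W`.»
B. Howard [Howard2012] Def. 3.1.1 (the `Φ`-determinant condition on `Lie(A)`).  G. Shimura [Shimura1998] §5.2
p. 39, §3.2.

WHAT IS PROVED (hypotheses `(ιF : F →+* A.endAlgebra) (hF : finrank ℚ F = 2 * A.dim)`; `c` any basis of `Lie(A)`
indexed by a finite type `n`; `L(a) = Motives.AbelianVariety.lieAction A (ιF a)`):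

* §1 `exists_basis_toMatrix_lieAction_eq_diagonal_reindex` (the eigenbasis of `Lie(A)` re-indexed along any
  `e : n ≃ Φ`).
* §2 **`det_sum_X_smul_toMatrix_lieAction_eq_prod`** — for EVERY family `x : ι → F` (no lift) and every basis `c`
  of `Lie(A)`: `det(∑ᵢ Xᵢ [L(xᵢ)]_c) = ∏_{φ ∈ Φ} (∑ᵢ Xᵢ φ(xᵢ))` in `ℂ[Xᵢ]`; **`det_sum_X_smul_toMatrix_lieAction_basis_eq_prod`**
  — KOTTWITZ'S `g = f` for a `ℚ`-BASIS `β` of `F`: `det(X₁β₁ + ⋯ + X_tβ_t ; Lie A) = ∏_{φ ∈ Φ} (∑ᵢ Xᵢ φ(βᵢ))`;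
  `det_sum_X_smul_toMatrix_lieAction_eq_prod_pow` (a family in a subfield `K₀`: exponents `m_ψ`).

Theorems only; no definition, no named fact, no `sorry` (net debt 0); axioms `propext`, `Classical.choice`,
`Quot.sound`.

## References
* [Kottwitz1992] R. E. Kottwitz, *Points on some Shimura varieties over finite fields*, J. Amer. Math. Soc. 5 (1992),
  §5, pp. 389–390.
* [Howard2012] B. Howard, Ann. of Math. (2) 176 (2012), Def. 3.1.1, §3.1.
* [Shimura1998] G. Shimura, *Abelian Varieties with Complex Multiplication and Modular Functions* (1998), §3.2, §5.2
  p. 39.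

## Provenance

Lane `lit-hodgefound` (HOME `run/shared/lean/pub/lit-hodgefound/`), prover seat `lit-hodgefound-p11` (gen 26),
self-proposed row g26-#14 (INBOX claim 2026-08-27).
-/

noncomputable section

namespace Literature.AlgebraicGeometry.ComplexMultiplication

open scoped Manifold Classical nonZeroDivisors
open CategoryTheory NumberField Module
open Literature.AlgebraicGeometry.Motives
open Literature.AlgebraicGeometry.HodgeTheory
open Literature.NumberTheory.ComplexMultiplication

namespace EndFieldFullDegree

variable {F : Type} [Field F] [NumberField F] {A : AbelianVariety ℂ}
  (ιF : F →+* A.endAlgebra) (hF : finrank ℚ F = 2 * A.dim) (K₀ : IntermediateField ℚ F)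

/-! ### §1 The eigenbasis of `Lie(A)`, re-indexed -/

/-- The eigenbasis of `Lie(A)` for `ι(F)` re-indexed along a bijection `e : n ≃ Φ`: `[L(a)] = diag((e k)(a))_k`.
[cite: Shimura1998, §5.2, p. 39; §3.2] -/
theorem exists_basis_toMatrix_lieAction_eq_diagonal_reindex {n : Type} [Fintype n] [DecidableEq n]
    (e : n ≃ (cmTypeOfPair ιF hF).1) :
    ∃ b : Basis n ℂ (Motives.AbelianVariety.Lie A),
      ∀ a : F, LinearMap.toMatrix b b (Motives.AbelianVariety.lieAction A (ιF a)) =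
        Matrix.diagonal fun k : n => ((e k).1 a : ℂ) := by
  obtain ⟨b, hb⟩ := exists_basis_lieAction_eq_smul ιF hF
  refine ⟨b.reindex e.symm, fun a => ?_⟩
  have hb' : ∀ k : n, Motives.AbelianVariety.lieAction A (ιF a) (b.reindex e.symm k) =
      ((e k).1 a : ℂ) • b.reindex e.symm k := fun k => by
    rw [Basis.reindex_apply, Equiv.symm_symm]
    exact hb (e k) a
  ext i j
  rw [LinearMap.toMatrix_apply, hb' j, map_smul, Finsupp.smul_apply, (b.reindex e.symm).repr_self,
    Matrix.diagonal_apply, Finsupp.single_apply, smul_eq_mul, mul_ite, mul_one, mul_zero]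
  by_cases h : i = j
  · subst h
    simp
  · rw [if_neg (Ne.symm h), if_neg h]

/-! ### §2 The determinant polynomial of `ι(F)` on `Lie(A)` -/

/-- Change of basis inside the determinant polynomial: for `P Q` with `P * Q = 1`,
`det (∑ i, X i • (P * M i * Q).map C) = det (∑ i, X i • (M i).map C)` in `MvPolynomial ι ℂ`. [folklore] -/
private theorem det_sum_X_smul_map_eq_of_mul_eq_one' {n : Type} [Fintype n] [DecidableEq n] {ι : Type} [Fintype ι]
    (P Q : Matrix n n ℂ) (hPQ : P * Q = 1) (M : ι → Matrix n n ℂ) :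
    (∑ i, (MvPolynomial.X i : MvPolynomial ι ℂ) •
        ((P * M i * Q).map MvPolynomial.C : Matrix n n (MvPolynomial ι ℂ))).det =
      (∑ i, (MvPolynomial.X i : MvPolynomial ι ℂ) •
        ((M i).map MvPolynomial.C : Matrix n n (MvPolynomial ι ℂ))).det := by
  set P' : Matrix n n (MvPolynomial ι ℂ) := P.map MvPolynomial.C with hP'
  set Q' : Matrix n n (MvPolynomial ι ℂ) := Q.map MvPolynomial.C with hQ'
  have hmul : ∀ i, (MvPolynomial.X i : MvPolynomial ι ℂ) •
      ((P * M i * Q).map MvPolynomial.C : Matrix n n (MvPolynomial ι ℂ)) =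
      P' * ((MvPolynomial.X i : MvPolynomial ι ℂ) • ((M i).map MvPolynomial.C : Matrix n n (MvPolynomial ι ℂ))) *
        Q' := by
    intro i
    rw [Matrix.map_mul, Matrix.map_mul, Matrix.mul_smul, Matrix.smul_mul]
  have hsum : ∑ i, (MvPolynomial.X i : MvPolynomial ι ℂ) •
      ((P * M i * Q).map MvPolynomial.C : Matrix n n (MvPolynomial ι ℂ)) =
      P' * (∑ i, (MvPolynomial.X i : MvPolynomial ι ℂ) •
        ((M i).map MvPolynomial.C : Matrix n n (MvPolynomial ι ℂ))) * Q' := by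
    rw [Finset.mul_sum, Finset.sum_mul]
    exact Finset.sum_congr rfl fun i _ => hmul i
  have hdet : P'.det * Q'.det = 1 := by
    rw [hP', hQ', ← Matrix.det_mul, ← Matrix.map_mul, hPQ]
    have h1 : ((1 : Matrix n n ℂ).map MvPolynomial.C : Matrix n n (MvPolynomial ι ℂ)) = 1 := by
      ext i j
      rw [Matrix.map_apply, Matrix.one_apply, Matrix.one_apply]
      split_ifs <;> simp
    rw [h1, Matrix.det_one]
  rw [hsum, Matrix.det_mul, Matrix.det_mul]
  linear_combination (∑ i, (MvPolynomial.X i : MvPolynomial ι ℂ) •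
    ((M i).map MvPolynomial.C : Matrix n n (MvPolynomial ι ℂ))).det * hdet

/-- The determinant polynomial of a family of DIAGONAL matrices. [folklore] -/
private theorem det_sum_X_smul_map_diagonal' {n : Type} [Fintype n] [DecidableEq n] {ι : Type} [Fintype ι]
    (d : ι → n → ℂ) :
    (∑ i, (MvPolynomial.X i : MvPolynomial ι ℂ) •
        ((Matrix.diagonal (d i)).map MvPolynomial.C : Matrix n n (MvPolynomial ι ℂ))).det =
      ∏ k : n, ∑ i, MvPolynomial.X i * MvPolynomial.C (d i k) := by
  have hdiag : ∑ i, (MvPolynomial.X i : MvPolynomial ι ℂ) •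
      ((Matrix.diagonal (d i)).map MvPolynomial.C : Matrix n n (MvPolynomial ι ℂ)) =
      Matrix.diagonal fun k : n => ∑ i, MvPolynomial.X i * MvPolynomial.C (d i k) := by
    ext k l
    simp only [Matrix.sum_apply, Matrix.smul_apply, Matrix.map_apply, Matrix.diagonal_apply]
    split_ifs with h
    · simp [smul_eq_mul]
    · simp
  rw [hdiag, Matrix.det_diagonal]


/-- **The determinant polynomial of ANY finite family of `ι(F)` on `Lie(A)`** (no lift to `End(A)` needed): for
`x : ι → F` and every basis `c` of `Lie(A)`, `det(∑ᵢ Xᵢ [L(xᵢ)]_c) = ∏_{φ ∈ Φ} (∑ᵢ Xᵢ φ(xᵢ))` in `ℂ[Xᵢ : i ∈ ι]`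
(«the determinant of `T₁x₁ + ⋯ + T_r x_r` acting on `Lie(A)` is `∏_{φ ∈ Φ}(T₁φ(x₁) + ⋯ + T_rφ(x_r))`»).
[cite: Howard2012, Def. 3.1.1 and §3.1] [cite: Kottwitz1992, §5 (pp. 389–390)] [cite: Shimura1998, §5.2, p. 39] -/
theorem det_sum_X_smul_toMatrix_lieAction_eq_prod {ι : Type} [Fintype ι] (x : ι → F) {n : Type} [Fintype n]
    [DecidableEq n] (c : Basis n ℂ (Motives.AbelianVariety.Lie A)) :
    (∑ i, (MvPolynomial.X i : MvPolynomial ι ℂ) •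
        ((LinearMap.toMatrix c c (Motives.AbelianVariety.lieAction A (ιF (x i)))).map MvPolynomial.C :
          Matrix n n (MvPolynomial ι ℂ))).det =
      ∏ σ : (cmTypeOfPair ιF hF).1, ∑ i, MvPolynomial.X i * MvPolynomial.C (σ.1 (x i) : ℂ) := by
  obtain ⟨b₀, -⟩ := exists_basis_lieAction_eq_smul ιF hF
  let e : n ≃ (cmTypeOfPair ιF hF).1 := c.indexEquiv b₀
  obtain ⟨b, hb⟩ := exists_basis_toMatrix_lieAction_eq_diagonal_reindex ιF hF e
  have hconj : ∀ i, LinearMap.toMatrix c c (Motives.AbelianVariety.lieAction A (ιF (x i))) =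
      c.toMatrix b * Matrix.diagonal (fun k : n => ((e k).1 (x i) : ℂ)) * b.toMatrix c := fun i => by
    rw [← hb (x i), basis_toMatrix_mul_linearMap_toMatrix_mul_basis_toMatrix]
  simp_rw [hconj]
  rw [det_sum_X_smul_map_eq_of_mul_eq_one' (c.toMatrix b) (b.toMatrix c) (c.toMatrix_mul_toMatrix_flip b) _,
    det_sum_X_smul_map_diagonal']
  exact Fintype.prod_equiv e _ _ fun k => rfl

/-- **KOTTWITZ'S DETERMINANT CONDITION `g = f` AS PRINTED, for a `ℚ`-BASIS `β` of `B = F`**: the determinant of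
`X₁β₁ + ⋯ + X_tβ_t` acting on `Lie(A)` (any basis of `Lie(A)`) is `∏_{φ ∈ Φ} (X₁φ(β₁) + ⋯ + X_tφ(β_t))`,
`t = [F : ℚ] = 2 dim A`. [cite: Kottwitz1992, §5 (pp. 389–390)] [cite: Howard2012, Def. 3.1.1] -/
theorem det_sum_X_smul_toMatrix_lieAction_basis_eq_prod {ι : Type} [Fintype ι] (β : Basis ι ℚ F) {n : Type}
    [Fintype n] [DecidableEq n] (c : Basis n ℂ (Motives.AbelianVariety.Lie A)) :
    (∑ i, (MvPolynomial.X i : MvPolynomial ι ℂ) •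
        ((LinearMap.toMatrix c c (Motives.AbelianVariety.lieAction A (ιF (β i)))).map MvPolynomial.C :
          Matrix n n (MvPolynomial ι ℂ))).det =
      ∏ σ : (cmTypeOfPair ιF hF).1, ∑ i, MvPolynomial.X i * MvPolynomial.C (σ.1 (β i) : ℂ) :=
  det_sum_X_smul_toMatrix_lieAction_eq_prod ιF hF β c

/-- The form over a subfield `K₀ ⊆ F` (family `x : ι → K₀`, no lift): `∏_{ψ : K₀ → ℂ} (∑ᵢ Xᵢ ψ(xᵢ))^{m_ψ}`,
`m_ψ = #{φ ∈ Φ : φ|_{K₀} = ψ}` — Kottwitz's `det_V` for `B = K₀`, `V = Lie(A)`. [cite: Kottwitz1992, §5 (p. 390)]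
[cite: Howard2012, §1] -/
theorem det_sum_X_smul_toMatrix_lieAction_eq_prod_pow {ι : Type} [Fintype ι] (x : ι → K₀) {n : Type} [Fintype n]
    [DecidableEq n] (c : Basis n ℂ (Motives.AbelianVariety.Lie A)) :
    (∑ i, (MvPolynomial.X i : MvPolynomial ι ℂ) •
        ((LinearMap.toMatrix c c (Motives.AbelianVariety.lieAction A (ιF (algebraMap K₀ F (x i))))).map
          MvPolynomial.C : Matrix n n (MvPolynomial ι ℂ))).det =
      ∏ ψ : K₀ →+* ℂ, (∑ i, MvPolynomial.X i * MvPolynomial.C (ψ (x i) : ℂ)) ^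
        Fintype.card {σ : (cmTypeOfPair ιF hF).1 // σ.1.comp (algebraMap K₀ F) = ψ} := by
  rw [det_sum_X_smul_toMatrix_lieAction_eq_prod ιF hF (fun i => algebraMap K₀ F (x i)) c]
  have h := Fintype.prod_fiberwise' (fun σ : (cmTypeOfPair ιF hF).1 ↦ σ.1.comp (algebraMap K₀ F))
    (fun ψ : K₀ →+* ℂ ↦ ∑ i, (MvPolynomial.X i : MvPolynomial ι ℂ) * MvPolynomial.C (ψ (x i) : ℂ))
  simp only [RingHom.comp_apply] at h
  rw [← h]
  refine Finset.prod_congr rfl fun ψ _ ↦ ?_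
  rw [Finset.prod_const, Finset.card_univ]

end EndFieldFullDegree

end Literature.AlgebraicGeometry.ComplexMultiplication

end
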